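import Summits.PneNP.PneNP.Theorems.ChebyshevTracialDesignLevelAttenuation
import HarnessLib

/-!
# Cell pnp-psdrank, route `ChebyshevTracialDesign`: the deep spectrum of every level kernel, in the shape the degree-truncation
# tail consumes

Harmonic backbone of the crux `TracialDecayExp20` (stmt-PneNP-19878), brick 13. Brick 12 (`…LevelAttenuation`) bounds every even
layer `2κ'` of the Gram kernel of the level-`(2m+1)` incidence between `t`-cuts (`t = 2c+1`) and perfect matchings by
`λ₀ · (1+ρ)^{2κ'} · Π_{i<κ'} (2i+1)/(n−2i)`, and the odd layers vanish. Here this is packaged as ONE bound for all layers beyond a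
truncation degree `K` — the hypothesis `hΛ : ∀ j, K < j → j ≤ t → kernelEigen n t j κ ≤ Λ` of lit's high-part Gram bound
`JohnsonSpectrum.sum_sq_gram_highPart_le` (degree truncation: low part priced exactly by the design, high part by the deep spectrum):

  `kernelEigen_level_le_of_lt`: for `K < j ≤ t`, `kernelEigen n t j κ_m ≤ λ₀(κ_m) · (1+ρ)^{2c} · Π_{i ≤ K/2} (2i+1)/(n−2i)`,

`ρ = 2m(2m+1)/(4(c−m+1)(n/2−c−m))` (the factors `(2i+1)/(n−2i) ≤ 1` beyond `K/2` are dropped, `(1+ρ)^{κ'} ≤ (1+ρ)^c`). For the design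
levels `2m+1 ≤ 4√n+3` of a balanced design, `(1+ρ)^{2c} ≤ e^{O(1)}` and `Π_{i ≤ K/2}(2i+1)/(n−2i) ≤ ((K+1)/(n−K))^{K/2+1}`: with `K = 2D`,
`D = dq n ≍ n^{1/4}`, the high part of every rectangle / psd strategy is `e^{−Ω(D log n)}`-small against every design level — the (ATT)
input of the route's two-layer plan (ATT ⇒ VIRT ⇒ TracialDecayExp20), now a tree theorem at every level and depth.
[cite: Rothvoss2017, §2 (PDF p. 6)] [cite: BrouwerHaemers2012, Prop. 4.3.2 (PDF p. 83)]
Stature: support/instrument. WHAT THIS IS NOT: not virtual positivity, nothing on psd rank, no P-vs-NP content. Supports stmt-PneNP-19878.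
-/

set_option linter.dupNamespace false -- `Summit.PneNP.PneNP.…`: summit = sub-problem (D-0017)

noncomputable section

namespace Summit.PneNP.PneNP.Theorems.ChebyshevTracialDesignLevelTail

open Finset Literature.Combinatorics.AssociationSchemes Literature.Combinatorics.AssociationSchemes.JohnsonHarmonics
open Literature.Combinatorics.AssociationSchemes.JohnsonSpectrum
open Literature.Barriers.PneNP
open Summit.PneNP.PneNP.Theorems.ChebyshevTracialDesignLevelAttenuation

variable {n : ℕ}

/-- The attenuation factors `(2i+1)/(n−2i)` are in `[0, 1]` for `4i + 1 ≤ n`. -/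
theorem atten_factor_le_one {i : ℕ} (hi : 4 * i + 1 ≤ n) :
    0 ≤ (2 * i + 1 : ℝ) / ((n : ℝ) - 2 * i) ∧ (2 * i + 1 : ℝ) / ((n : ℝ) - 2 * i) ≤ 1 := by
  have hn : ((4 * i + 1 : ℕ) : ℝ) ≤ n := by exact_mod_cast hi
  push_cast at hn
  have hpos : (0 : ℝ) < (n : ℝ) - 2 * i := by linarith
  exact ⟨div_nonneg (by positivity) hpos.le, (div_le_one hpos).2 (by linarith)⟩

/-- The partial products `Π_{i<κ'} (2i+1)/(n−2i)` are non-increasing in `κ'` as long as `4κ' ≤ n + 2`: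
for `k ≤ κ'` with `4(κ'−1)+1 ≤ n`, `Π_{i<κ'} ≤ Π_{i<k}`. -/
theorem prod_atten_le_of_le {k κ' : ℕ} (hk : k ≤ κ') (hκ : 4 * κ' ≤ n + 3) :
    ∏ i ∈ range κ', ((2 * i + 1 : ℝ) / ((n : ℝ) - 2 * i)) ≤ ∏ i ∈ range k, ((2 * i + 1 : ℝ) / ((n : ℝ) - 2 * i)) := by
  rw [← prod_range_mul_prod_Ico _ hk]
  refine mul_le_of_le_one_right (prod_nonneg fun i hi => (atten_factor_le_one (by
    have := mem_range.1 hi; omega)).1) ?_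
  refine prod_le_one (fun i hi => (atten_factor_le_one (by have := (mem_Ico.1 hi).2; omega)).1)
    (fun i hi => (atten_factor_le_one (by have := (mem_Ico.1 hi).2; omega)).2)

/-- `λ₀ ≥ 0` for the Gram kernel of a `0/1` incidence with class-function Gram matrix: `λ₀ = d_R · d_C` with `d_R, d_C ≥ 0`. -/
theorem kernelEigen_level_zero_nonneg {c m : ℕ} (ht : 2 * (2 * c + 1) ≤ n) (κm : ℕ → ℝ)
    (hAm : ∀ U ∈ univ.powersetCard (2 * c + 1), ∀ U' ∈ univ.powersetCard (2 * c + 1),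
      ∑ M : PMatch n, (if (U.filter fun x => M.2.partner x ∉ U).card = 2 * m + 1 then (1 : ℝ) else 0) *
        (if (U'.filter fun x => M.2.partner x ∉ U').card = 2 * m + 1 then (1 : ℝ) else 0) = κm (U ∩ U').card) :
    0 ≤ kernelEigen n (2 * c + 1) 0 κm := by
  classical
  obtain ⟨U₁, hU₁⟩ : ∃ U : Finset (Fin n), U ∈ univ.powersetCard (2 * c + 1) := by
    have : (univ.powersetCard (2 * c + 1) : Finset (Finset (Fin n))).Nonempty := by
      apply powersetCard_nonempty.2; rw [card_univ, Fintype.card_fin]; omega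
    exact this
  have hU₁t : U₁.card = 2 * c + 1 := (mem_powersetCard.1 hU₁).2
  rw [← sum_kernel_eq_kernelEigen_zero κm hU₁t, ← sum_congr rfl fun U' hU' => hAm U₁ hU₁ U' hU']
  exact sum_nonneg fun U' _ => sum_nonneg fun M _ => by split_ifs <;> simp

/-- **The deep spectrum of a level kernel, uniformly beyond a truncation degree.** For `n` even, `t = 2c+1`, `2t ≤ n`, `m ≤ c`,
`K ≤ 2c`, with `κ₁` the Gram class function of the tight incidence and `κ_m` that of the level-`(2m+1)` incidence on the `t`-sets:
for every layer `K < j ≤ t`,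
`kernelEigen n t j κ_m ≤ kernelEigen n t 0 κ_m · ((1+ρ)^c)² · Π_{i < K/2+1} (2i+1)/(n−2i)`, `ρ = 2m(2m+1)/(4(c−m+1)(n/2−c−m))` —
the hypothesis `hΛ` of `JohnsonSpectrum.sum_sq_gram_highPart_le` for the level-`(2m+1)` relation.
[cite: Rothvoss2017, §2 (PDF p. 6)] [cite: BrouwerHaemers2012, Prop. 4.3.2 (PDF p. 83)] -/
theorem kernelEigen_level_le_of_lt {c m K : ℕ} (hn : Even n) (ht : 2 * (2 * c + 1) ≤ n) (hmc : m ≤ c) (hKc : K ≤ 2 * c)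
    (κ₁ κm : ℕ → ℝ)
    (hA1 : ∀ U ∈ univ.powersetCard (2 * c + 1), ∀ U' ∈ univ.powersetCard (2 * c + 1),
      ∑ M : PMatch n, (if (U.filter fun x => M.2.partner x ∉ U).card = 1 then (1 : ℝ) else 0) *
        (if (U'.filter fun x => M.2.partner x ∉ U').card = 1 then (1 : ℝ) else 0) = κ₁ (U ∩ U').card)
    (hAm : ∀ U ∈ univ.powersetCard (2 * c + 1), ∀ U' ∈ univ.powersetCard (2 * c + 1),
      ∑ M : PMatch n, (if (U.filter fun x => M.2.partner x ∉ U).card = 2 * m + 1 then (1 : ℝ) else 0) *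
        (if (U'.filter fun x => M.2.partner x ∉ U').card = 2 * m + 1 then (1 : ℝ) else 0) = κm (U ∩ U').card)
    {j : ℕ} (hKj : K < j) (hjt : j ≤ 2 * c + 1) :
    kernelEigen n (2 * c + 1) j κm ≤
      kernelEigen n (2 * c + 1) 0 κm *
        ((1 + (2 * m * (2 * m + 1) : ℝ) / (4 * (c - m + 1) * ((n / 2 - c - m : ℕ) : ℝ))) ^ c) ^ 2 *
        ∏ i ∈ range (K / 2 + 1), ((2 * i + 1 : ℝ) / ((n : ℝ) - 2 * i)) := by
  have hl0 := kernelEigen_level_zero_nonneg ht κm hAm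
  have hρ : 0 ≤ (2 * m * (2 * m + 1) : ℝ) / (4 * (c - m + 1) * ((n / 2 - c - m : ℕ) : ℝ)) := by
    have : (m : ℝ) ≤ c := by exact_mod_cast hmc
    have : (0 : ℝ) ≤ (c : ℝ) - m + 1 := by linarith
    positivity
  have hP : 0 ≤ ∏ i ∈ range (K / 2 + 1), ((2 * i + 1 : ℝ) / ((n : ℝ) - 2 * i)) :=
    prod_nonneg fun i hi => (atten_factor_le_one (by have := mem_range.1 hi; omega)).1
  rcases Nat.even_or_odd j with ⟨κ', hκ'⟩ | hodd
  · -- even layer `j = 2κ'` with `K/2 + 1 ≤ κ' ≤ c`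
    have hj : j = 2 * κ' := by omega
    have hκc : κ' ≤ c := by omega
    have hKκ : K / 2 + 1 ≤ κ' := by omega
    rw [hj]
    refine (kernelEigen_level_le hn ht hκc hmc κ₁ κm hA1 hAm).trans ?_
    have h1 : ((1 + (2 * m * (2 * m + 1) : ℝ) / (4 * (c - m + 1) * ((n / 2 - c - m : ℕ) : ℝ))) ^ κ') ^ 2 ≤
        ((1 + (2 * m * (2 * m + 1) : ℝ) / (4 * (c - m + 1) * ((n / 2 - c - m : ℕ) : ℝ))) ^ c) ^ 2 := by
      have hb : (1 : ℝ) ≤ 1 + (2 * m * (2 * m + 1) : ℝ) / (4 * (c - m + 1) * ((n / 2 - c - m : ℕ) : ℝ)) := by linarith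
      exact pow_le_pow_left₀ (by positivity) (pow_le_pow_right₀ hb hκc) 2
    have h2 := prod_atten_le_of_le (n := n) hKκ (by omega)
    calc kernelEigen n (2 * c + 1) 0 κm *
          ((1 + (2 * m * (2 * m + 1) : ℝ) / (4 * (c - m + 1) * ((n / 2 - c - m : ℕ) : ℝ))) ^ κ') ^ 2 *
          ∏ i ∈ range κ', ((2 * i + 1 : ℝ) / ((n : ℝ) - 2 * i))
        ≤ kernelEigen n (2 * c + 1) 0 κm *
          ((1 + (2 * m * (2 * m + 1) : ℝ) / (4 * (c - m + 1) * ((n / 2 - c - m : ℕ) : ℝ))) ^ c) ^ 2 *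
          ∏ i ∈ range κ', ((2 * i + 1 : ℝ) / ((n : ℝ) - 2 * i)) :=
          mul_le_mul_of_nonneg_right (mul_le_mul_of_nonneg_left h1 hl0)
            (prod_nonneg fun i hi => (atten_factor_le_one (by have := mem_range.1 hi; omega)).1)
      _ ≤ _ := mul_le_mul_of_nonneg_left h2 (by positivity)
  · -- odd layers vanish
    rw [kernelEigen_level_eq_zero_of_odd ht hmc hjt hodd κm hAm]
    positivity

/-! ### §2 Unconditional forms: the Gram class functions exist (appended)

The hypotheses `hA1` / `hAm` of bricks 12–13 (the Gram matrix of the incidence is a class function of `|U ∩ U'|`) hold for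
every odd `t` and every crossing count, by the route's pair-transitivity count `card_filter_cc_cc_eq` (p430440); so the
attenuation bound needs no input besides `n` even, `t = 2c+1 ≤ n/2`, `κ' ≤ c`, `m ≤ c`. -/

section Uncond

open Summit.PneNP.PneNP.Theorems.ChebyshevTracialDesignTightColumnSums
open Summit.PneNP.PneNP.Theorems.ChebyshevTracialDesignTightFreeSpectral
open Summit.PneNP.PneNP.Theorems.ChebyshevTracialDesignPairTransitive

/-- The Gram sum of the level-`r` incidence at two odd sets is the joint level count of the route vocabulary. -/
theorem levelGram_eq_card (r : ℕ) {U U' : Finset (Fin n)} (hU : Odd U.card) (hU' : Odd U'.card) :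
    ∑ M : PMatch n, (if (U.filter fun x => M.2.partner x ∉ U).card = r then (1 : ℝ) else 0) *
        (if (U'.filter fun x => M.2.partner x ∉ U').card = r then (1 : ℝ) else 0) =
      ((univ.filter fun M : PMatch n => cc ⟨U, hU⟩ M = r ∧ cc ⟨U', hU'⟩ M = r).card : ℝ) := by
  rw [← sum_boole]
  refine sum_congr rfl fun M _ => ?_
  rw [cc_eq_card_filter_partner ⟨U, hU⟩ M, cc_eq_card_filter_partner ⟨U', hU'⟩ M]
  simp only
  split_ifs <;> simp_all

/-- **The Gram kernel of every level incidence on the `t`-subsets (`t` odd) is a class function of `|U ∩ U'|`.**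
[cite: Rothvoss2017, §2 (PDF p. 6)] -/
theorem exists_levelGram_classFunction {t : ℕ} (ht : Odd t) (r : ℕ) :
    ∃ κ : ℕ → ℝ, ∀ U ∈ univ.powersetCard t, ∀ U' ∈ univ.powersetCard t,
      ∑ M : PMatch n, (if (U.filter fun x => M.2.partner x ∉ U).card = r then (1 : ℝ) else 0) *
        (if (U'.filter fun x => M.2.partner x ∉ U').card = r then (1 : ℝ) else 0) = κ (U ∩ U').card := by
  classical
  refine ⟨fun x => if h : ∃ UU : Finset (Fin n) × Finset (Fin n),
      UU.1.card = t ∧ UU.2.card = t ∧ (UU.1 ∩ UU.2).card = x then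
      ∑ M : PMatch n, (if (h.choose.1.filter fun y => M.2.partner y ∉ h.choose.1).card = r then (1 : ℝ) else 0) *
        (if (h.choose.2.filter fun y => M.2.partner y ∉ h.choose.2).card = r then (1 : ℝ) else 0) else 0,
    fun U hU U' hU' => ?_⟩
  have hUt : U.card = t := (mem_powersetCard.1 hU).2
  have hU't : U'.card = t := (mem_powersetCard.1 hU').2
  have hex : ∃ UU : Finset (Fin n) × Finset (Fin n), UU.1.card = t ∧ UU.2.card = t ∧ (UU.1 ∩ UU.2).card = (U ∩ U').card :=
    ⟨(U, U'), hUt, hU't, rfl⟩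
  dsimp only
  rw [dif_pos hex]
  obtain ⟨h1, h2, h3⟩ := hex.choose_spec
  have hoU : Odd U.card := by rw [hUt]; exact ht
  have hoU' : Odd U'.card := by rw [hU't]; exact ht
  have ho1 : Odd hex.choose.1.card := by rw [h1]; exact ht
  have ho2 : Odd hex.choose.2.card := by rw [h2]; exact ht
  rw [levelGram_eq_card r hoU hoU', levelGram_eq_card r ho1 ho2]
  exact_mod_cast card_filter_cc_cc_eq r r ⟨U, hoU⟩ ⟨U', hoU'⟩ ⟨_, ho1⟩ ⟨_, ho2⟩ (by rw [hUt, h1]) (by rw [hU't, h2]) h3.symm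

/-- **(ATT) at every level and every even layer, unconditional form**: for `n` even, `t = 2c+1`, `2t ≤ n`, `κ' ≤ c`, `m ≤ c` and ANY
Gram class function `κ_m` of the level-`(2m+1)` incidence on the `t`-sets,
`kernelEigen n t (2κ') κ_m ≤ kernelEigen n t 0 κ_m · ((1+ρ)^{κ'})² · Π_{i<κ'} (2i+1)/(n−2i)`, `ρ = 2m(2m+1)/(4(c−m+1)(n/2−c−m))`.
[cite: Rothvoss2017, §2 (PDF p. 6)] [cite: GodsilMeagher2015, §15.2 (perfect matching scheme)] -/
theorem kernelEigen_level_le_uncond {c κ' m : ℕ} (hn : Even n) (ht : 2 * (2 * c + 1) ≤ n) (hκc : κ' ≤ c) (hmc : m ≤ c)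
    (κm : ℕ → ℝ)
    (hAm : ∀ U ∈ univ.powersetCard (2 * c + 1), ∀ U' ∈ univ.powersetCard (2 * c + 1),
      ∑ M : PMatch n, (if (U.filter fun x => M.2.partner x ∉ U).card = 2 * m + 1 then (1 : ℝ) else 0) *
        (if (U'.filter fun x => M.2.partner x ∉ U').card = 2 * m + 1 then (1 : ℝ) else 0) = κm (U ∩ U').card) :
    kernelEigen n (2 * c + 1) (2 * κ') κm ≤
      kernelEigen n (2 * c + 1) 0 κm *
        ((1 + (2 * m * (2 * m + 1) : ℝ) / (4 * (c - m + 1) * ((n / 2 - c - m : ℕ) : ℝ))) ^ κ') ^ 2 *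
        ∏ i ∈ range κ', ((2 * i + 1 : ℝ) / ((n : ℝ) - 2 * i)) := by
  obtain ⟨κ₁, hA1⟩ := exists_tightGram_classFunction (n := n) (t := 2 * c + 1) ⟨c, rfl⟩
  exact kernelEigen_level_le hn ht hκc hmc κ₁ κm hA1 hAm

/-- **The deep spectrum beyond a truncation degree, unconditional form** (the `hΛ` hypothesis of
`JohnsonSpectrum.sum_sq_gram_highPart_le` for the level-`(2m+1)` relation): for `K < j ≤ t = 2c+1` (`n` even, `2t ≤ n`, `m ≤ c`,
`K ≤ 2c`), `kernelEigen n t j κ_m ≤ kernelEigen n t 0 κ_m · ((1+ρ)^c)² · Π_{i<K/2+1} (2i+1)/(n−2i)`. [cite: Rothvoss2017, §2 (PDF p. 6)] -/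
theorem kernelEigen_level_le_of_lt_uncond {c m K : ℕ} (hn : Even n) (ht : 2 * (2 * c + 1) ≤ n) (hmc : m ≤ c) (hKc : K ≤ 2 * c)
    (κm : ℕ → ℝ)
    (hAm : ∀ U ∈ univ.powersetCard (2 * c + 1), ∀ U' ∈ univ.powersetCard (2 * c + 1),
      ∑ M : PMatch n, (if (U.filter fun x => M.2.partner x ∉ U).card = 2 * m + 1 then (1 : ℝ) else 0) *
        (if (U'.filter fun x => M.2.partner x ∉ U').card = 2 * m + 1 then (1 : ℝ) else 0) = κm (U ∩ U').card)
    {j : ℕ} (hKj : K < j) (hjt : j ≤ 2 * c + 1) :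
    kernelEigen n (2 * c + 1) j κm ≤
      kernelEigen n (2 * c + 1) 0 κm *
        ((1 + (2 * m * (2 * m + 1) : ℝ) / (4 * (c - m + 1) * ((n / 2 - c - m : ℕ) : ℝ))) ^ c) ^ 2 *
        ∏ i ∈ range (K / 2 + 1), ((2 * i + 1 : ℝ) / ((n : ℝ) - 2 * i)) := by
  obtain ⟨κ₁, hA1⟩ := exists_tightGram_classFunction (n := n) (t := 2 * c + 1) ⟨c, rfl⟩
  exact kernelEigen_level_le_of_lt hn ht hmc hKc κ₁ κm hA1 hAm hKj hjt

end Uncond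

end Summit.PneNP.PneNP.Theorems.ChebyshevTracialDesignLevelTail
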